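import Summits.AtomisticToContinuum.Crystallization.Theses.ThreeConeCertificate
import Summits.AtomisticToContinuum.Crystallization.Theorems.ThreeConeCertificateOnePercentCertificateReduction
import Summits.AtomisticToContinuum.Crystallization.Theorems.ThreeConeCertificateOnePercentCertificatePruning
import Summits.AtomisticToContinuum.Crystallization.Theorems.ThreeConeCertificateOnePercentCertificateBondWeights
import Summits.AtomisticToContinuum.Crystallization.Theorems.ThreeConeCertificateOnePercentCertificateNearMinSeparation
import Summits.AtomisticToContinuum.Crystallization.Theorems.OnePercentCertificate.Negative.StubLocal

/-!
# `OnePercentCertificate` (stmt-AtomisticToContinuum-11958) — line `perron-gauge-Sketch`: skeleton v3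

Lead prover-line-stmt-AtomisticToContinuum-11958-a1-0 (2026-08-17).  Line `perron-gauge` (card
`Cruxes/OnePercentCertificate/Ideas/perron-gauge.md`, rev 5).

The crux reduces (tree, `OnePercentReduction.onePercentCertificate_of_local`, p112372) to the `cS`-stability of
the finite-range part `gS` of the explicit split of `ThreeConeCertificateDefs.lean`.  Landed by this line:
* pruning (`PerronGauge.stable_of_stableOnPruned`, p143813): it suffices to certify injective configurations all
  of whose `gS`-site energies are `≤ 0` — and these are automatically `1/8`-separated
  (`PerronGauge.stub_separated_of_siteEnergy_le`, p141961; ε-minimiser variant `local_of_stableOnSeparated`,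
  p143005, with `stub_nearMin_siteEnergy`, p141929);
* checkers: the bond-weight lemma `PerronGauge.stable_of_bondWeights` (p143554; any weights with
  `w_ij + w_ji ≥ 2`, e.g. the site-ball Dirichlet–Perron weights with AM–GM defect of card rev 5), the positive
  gauge / weighted Schur test `PerronGauge.weightedStability_of_gauge` and `stable_of_weightedStability`
  (p142535, for the operator form C⁺).
So the crux is literally `stub_stableOnPruned → OnePercentCertificate`, and a certificate of the stub is a
family of bond weights checked by `stableOnPruned_of_bondWeights` below.

Stub (the only sorry): `stub_stableOnPruned`.  Composition: `OnePercentCertificate_of` concludes the crux BY NAME.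
-/

noncomputable section

open scoped BigOperators
open Literature.MathematicalPhysics.StatisticalMechanics
open Summit.AtomisticToContinuum.Crystallization.Theorems
open Summit.AtomisticToContinuum.Crystallization.Theorems.ThreeConeSplit

namespace Summit.AtomisticToContinuum.Crystallization.Theorems.PerronGauge

/-! ## The stub -/

/-- STUB (the line's whole content): the finite-range part `gS` of the tree split is `cS`-stable on PRUNED
injective configurations (all site energies `≤ 0`; such configurations are `1/8`-separated by
`stub_separated_of_siteEnergy_le`).  `cS = 657987/10⁶`; close packings reach `−0.651259·N` (margin `1.03 %`).
Intended certificate: site-ball Dirichlet–Perron bond weights with AM–GM defect, radius `R`, checked by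
`stableOnPruned_of_bondWeights`. [folklore] -/
theorem stub_stableOnPruned :
    ∀ (N : ℕ) (x : Fin N → EuclideanSpace ℝ (Fin 3)), Function.Injective x →
      (∀ i, siteEnergy gS x i ≤ 0) → -(cS * (N : ℝ)) ≤ interactionEnergy gS x := by
  sorry

/-! ## Certificate interface (how the stub is meant to be discharged) -/

/-- **Certificate interface.** Bond weights `w` (depending on the configuration) with `w_ij + w_ji ≥ 2` on all
pairs and weighted stars `Σ_{j≠i} (att(r_ij) w_ij − rep(r_ij)) ≤ 2cS` at every site of every pruned injective
configuration prove the stub (`stable_of_bondWeights`, p143554). [folklore] -/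
theorem stableOnPruned_of_bondWeights
    (h : ∀ (N : ℕ) (x : Fin N → EuclideanSpace ℝ (Fin 3)), Function.Injective x →
      (∀ i, siteEnergy gS x i ≤ 0) →
      ∃ w : Fin N → Fin N → ℝ, (∀ i j, i ≠ j → 2 ≤ w i j + w j i) ∧
        ∀ i, ∑ j ∈ Finset.univ.erase i,
          (max (-gS (dist (x i) (x j))) 0 * w i j - max (gS (dist (x i) (x j))) 0) ≤ 2 * cS) :
    ∀ (N : ℕ) (x : Fin N → EuclideanSpace ℝ (Fin 3)), Function.Injective x →
      (∀ i, siteEnergy gS x i ≤ 0) → -(cS * (N : ℝ)) ≤ interactionEnergy gS x := by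
  intro N x hx hpr
  obtain ⟨w, hw, hstar⟩ := h N x hx hpr
  exact stable_of_bondWeights gS cS N x w hw hstar

/-! ## Composition -/

/-- `0 ≤ cS` (`cS = 657987/10⁶`). [folklore] -/
theorem cS_nonneg : 0 ≤ cS := by
  rw [StubLocal.cS_eq]; norm_num

/-- **Composition.** The stub gives the crux `OnePercentCertificate` by name: pruning
(`stable_of_stableOnPruned`, `0 ≤ cS`) removes the site-energy hypothesis, and the tree reduction
`OnePercentReduction.onePercentCertificate_of_local` (p112372) supplies decomposition, slack sign, range,
positive type and value for the split `(cS, gS, US, fS)`. -/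
theorem OnePercentCertificate_of :
    Summit.AtomisticToContinuum.Crystallization.Theses.ThreeConeCertificate.OnePercentCertificate :=
  OnePercentReduction.onePercentCertificate_of_local
    (stable_of_stableOnPruned gS cS cS_nonneg stub_stableOnPruned)

end Summit.AtomisticToContinuum.Crystallization.Theorems.PerronGauge
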